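import Summits.Langlands.Langlands.Theorems.RegularAdjointLiftCM.Negative.KillCriterion
import Literature.NumberTheory.Automorphic.AutomorphicRepCentralCharacter
import Literature.NumberTheory.GaloisRepresentations.HeckeCharacterWeakApproximation

/-!
# `RegularAdjointLiftCM` — negative lane II: the centre of the conclusion (`ν³ = ω_π`)

Refuter-side support for the crux `RegularAdjointLiftCM` (item stmt-Langlands-13617, route
`route-Langlands-IrreducibilityBySelfDuality`), cycle 2 of the standing disprover
(`Cruxes/RegularAdjointLiftCM/Disproof.lean` §8–§9).  No statement of the route is proved or refuted;
every relation below is the route text VERBATIM (the adjoint relation `t_π = d · Ad(t_σ)` of the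
conclusion, the essential self-duality `t_π⁻¹ = e · t_π` of the hypothesis), over ANY number field.

* `adRel_cube` — `t_π = ν · Ad(t_σ)` a.e. ⇒ `det t_{π,v} = d_v³` a.e.: the GL(1) datum `ν` of the
  conclusion is pinned by `π` up to a.e. cube roots of unity (`adRel_cube_unique`).
* `essSelfDual_cube` — `t_π⁻¹ = e · t_π` a.e. ⇒ `e_v³ (det t_{π,v})² = 1` a.e.; with the previous,
  `(e_v d_v²)³ = 1` (`adRel_essSelfDual_cube`): Thm A's normalisation `d² e = 1` is a CHOICE of `ν` in
  its `μ₃`-coset, not a consequence of the conclusion.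
* `adRel_heckeCharacter_cube_eq_centralCharacter` — GLOBALLY `θ³ = ω_π` for the Hecke character `θ` of
  `ν` and the central character `ω_π` (`AutomorphicRepData.exists_centralCharacter`,
  `HeckeCharacter.ext_of_eventually_valueAtUniformizer_eq`, both proved); likewise `ε³ ω_π² = 1` for
  the character `ε` of `η` (`essSelfDual_heckeCharacter_cube`).  Hence the conjunct "`ν` regular
  algebraic" of the crux is the archimedean statement "the Hecke cube roots of `ω_π` are algebraic" —
  no `σ`, no Gelbart–Jacquet at infinity, no `IsCMField`.
* `nuShadow_integral` and its tightness witnesses — the exponent bookkeeping of that statement: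
  `3P = A_σ`, `3Q = A_σ̄`, `P - Q ∈ ℤ` and Clozel purity `A_σ + A_σ̄ = 3w` force `P, Q ∈ ℤ`; purity and
  the character condition are each load-bearing; essential self-duality + purity force `3 ∣ A_σ`
  (`essSelfDual_centre_cube`) — a one-line sanity test on any candidate counterexample.
-/

open scoped BigOperators Topology Classical
open Filter Set Function IsDedekindDomain NumberField
open Literature.NumberTheory.Automorphic
open Literature.NumberTheory.GaloisRepresentations (HeckeCharacter)

noncomputable section

namespace Summit.Langlands.Langlands.Theorems.RegularAdjointLiftCM.Negative

variable {F : Type} [Field F] [NumberField F] {hF1 : isCompact_glFiniteIntegralLevel 1 F}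
  {hF2 : isCompact_glFiniteIntegralLevel 2 F} {hF3 : isCompact_glFiniteIntegralLevel 3 F}

/-! ### Satake level -/

/-- GL(1) Satake values are pinned: two singleton Satake parameters at `v` agree (Flath's
uniqueness, tree `hasSatakeParamAt_unique_holds`). [cite: Flath1979, Thm. 3] -/
theorem eq_of_hasSatakeParamAt_singleton {χ : CuspidalAutomorphicRepData 1 F hF1}
    {v : HeightOneSpectrum (𝓞 F)} {c c' : ℂ} (h : χ.1.HasSatakeParamAt v {c})
    (h' : χ.1.HasSatakeParamAt v {c'}) : c = c' :=
  Multiset.singleton_inj.mp (χ.1.hasSatakeParamAt_unique_holds h h')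

/-- A GL(1) datum has, at almost every place, a (singleton) Satake parameter.
[cite: Flath1979, Thm. 3] -/
theorem eventually_exists_hasSatakeParamAt_singleton (χ : CuspidalAutomorphicRepData 1 F hF1) :
    ∀ᶠ v in cofinite, ∃ c : ℂ, χ.1.HasSatakeParamAt v {c} := by
  filter_upwards [χ.1.hasSatakeParamAt_cofinite_holds] with v hv
  obtain ⟨α, hα⟩ := hv
  obtain ⟨c, rfl⟩ := Multiset.card_eq_one.mp hα.card_eq
  exact ⟨c, hα⟩

/-- `det (d · Ad(β)) = d³` for a genuine `GL₂` Satake parameter `β` (two non-zero entries).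
[folklore] -/
theorem prod_map_mul_adParams {β : Multiset ℂ} (hβ2 : Multiset.card β = 2) (hβ0 : (0 : ℂ) ∉ β)
    (d : ℂ) : ((adParams β).map (fun c => d * c)).prod = d ^ 3 := by
  obtain ⟨x, y, rfl⟩ := Multiset.card_eq_two.mp hβ2
  have hx : x ≠ 0 := fun h => hβ0 (by simp [h])
  have hy : y ≠ 0 := fun h => hβ0 (by simp [h])
  exact prod_adParams_twist_pair d hx hy

/-- **`ν³ = ω_π` at Satake level.**  If `t_π = ν · Ad(t_σ)` a.e. (the adjoint relation of the
conclusion of `RegularAdjointLiftCM`, verbatim) then a.e. `det t_{π,v} = d_v³`; `det t_{π,v}` is the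
`i = n` Hecke eigenvalue `ω_π(ϖ_v)` (Gelbart 1997, §7.1 (a)).
[cite: BorelJacquetCorvallis1979, §4.6 and 5.7] -/
theorem adRel_cube {π : CuspidalAutomorphicRepData 3 F hF3} {σ : CuspidalAutomorphicRepData 2 F hF2}
    {ν : CuspidalAutomorphicRepData 1 F hF1}
    (h : ∀ᶠ v in cofinite, ∀ α β : Multiset ℂ, π.1.HasSatakeParamAt v α →
      σ.1.HasSatakeParamAt v β → ∃ d : ℂ, ν.1.HasSatakeParamAt v {d} ∧
        α = (((β ×ˢ β).map (fun p : ℂ × ℂ => p.1 * p.2⁻¹)).erase 1).map (fun c => d * c)) :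
    ∀ᶠ v in cofinite, ∀ (α : Multiset ℂ) (d : ℂ), π.1.HasSatakeParamAt v α →
      ν.1.HasSatakeParamAt v {d} → α.prod = d ^ 3 := by
  have hcof : ∀ᶠ v in cofinite, σ.1.IsUnramifiedAt v := σ.1.hasSatakeParamAt_cofinite_holds
  filter_upwards [h, hcof] with v hv hur α d hα hd
  obtain ⟨β, hβ⟩ := hur
  obtain ⟨d', hd', hαd⟩ := hv α β hα hβ
  rw [hαd, eq_of_hasSatakeParamAt_singleton hd' hd]
  exact prod_map_mul_adParams hβ.card_eq hβ.zero_not_mem d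

/-- **`η³ ω_π² = 1` at Satake level.**  Essential self-duality `t_π⁻¹ = e · t_π` a.e. (the hypothesis
of the crux, verbatim) forces `e_v³ (det t_{π,v})² = 1` a.e. (determinants; `card t_π = 3`, entries
non-zero). [cite: Ramakrishnan2014, Theorem A] -/
theorem essSelfDual_cube {π : CuspidalAutomorphicRepData 3 F hF3}
    {η : CuspidalAutomorphicRepData 1 F hF1}
    (h : ∀ᶠ v in cofinite, ∀ α : Multiset ℂ, π.1.HasSatakeParamAt v α →
      ∃ e : ℂ, η.1.HasSatakeParamAt v {e} ∧ α.map (fun a => a⁻¹) = α.map (fun a => e * a)) :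
    ∀ᶠ v in cofinite, ∀ (α : Multiset ℂ) (e : ℂ), π.1.HasSatakeParamAt v α →
      η.1.HasSatakeParamAt v {e} → e ^ 3 * α.prod ^ 2 = 1 := by
  filter_upwards [h] with v hv α e hα he
  obtain ⟨e', he', hmap⟩ := hv α hα
  obtain rfl : e' = e := eq_of_hasSatakeParamAt_singleton he' he
  have hcard : Multiset.card α = 3 := hα.card_eq
  have hprod0 : α.prod ≠ 0 := Multiset.prod_ne_zero hα.zero_not_mem
  have key := congrArg Multiset.prod hmap
  rw [Multiset.prod_map_inv, Multiset.prod_map_mul, Multiset.map_const', Multiset.prod_replicate,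
    Multiset.map_id', hcard] at key
  have : e' ^ 3 * α.prod ^ 2 = α.prod⁻¹ * α.prod := by rw [key]; ring
  rw [this, inv_mul_cancel₀ hprod0]

/-- **`ν` is unique up to a.e. cube roots of unity**: two pairs `(σ, ν)`, `(σ', ν')` in the adjoint
relation with the same `π` have `d_v³ = d'_v³` a.e. [cite: BorelJacquetCorvallis1979, §4.6 and 5.7] -/
theorem adRel_cube_unique {π : CuspidalAutomorphicRepData 3 F hF3}
    {σ σ' : CuspidalAutomorphicRepData 2 F hF2} {ν ν' : CuspidalAutomorphicRepData 1 F hF1}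
    (h : ∀ᶠ v in cofinite, ∀ α β : Multiset ℂ, π.1.HasSatakeParamAt v α →
      σ.1.HasSatakeParamAt v β → ∃ d : ℂ, ν.1.HasSatakeParamAt v {d} ∧
        α = (((β ×ˢ β).map (fun p : ℂ × ℂ => p.1 * p.2⁻¹)).erase 1).map (fun c => d * c))
    (h' : ∀ᶠ v in cofinite, ∀ α β : Multiset ℂ, π.1.HasSatakeParamAt v α →
      σ'.1.HasSatakeParamAt v β → ∃ d : ℂ, ν'.1.HasSatakeParamAt v {d} ∧
        α = (((β ×ˢ β).map (fun p : ℂ × ℂ => p.1 * p.2⁻¹)).erase 1).map (fun c => d * c)) :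
    ∀ᶠ v in cofinite, ∀ d d' : ℂ, ν.1.HasSatakeParamAt v {d} → ν'.1.HasSatakeParamAt v {d'} →
      d ^ 3 = d' ^ 3 := by
  have hcof : ∀ᶠ v in cofinite, π.1.IsUnramifiedAt v := π.1.hasSatakeParamAt_cofinite_holds
  filter_upwards [adRel_cube h, adRel_cube h', hcof] with v hv hv' hur d d' hd hd'
  obtain ⟨α, hα⟩ := hur
  rw [← hv α d hα hd, ← hv' α d' hα hd']

/-- **Hypothesis vs conclusion at the centre**: under the adjoint relation and essential
self-duality, `(e_v d_v²)³ = 1` a.e. — `d² e` is an a.e. cube root of unity, not necessarily `1`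
(Thm A's output normalisation `d² e = 1` is a choice of `ν` inside its `μ₃`-coset; for `π` with a
cubic self-twist `μ`, `ν ↦ ν μ` keeps the adjoint relation and breaks `d² e = 1`).
[cite: Ramakrishnan2014, Theorem A] -/
theorem adRel_essSelfDual_cube {π : CuspidalAutomorphicRepData 3 F hF3}
    {σ : CuspidalAutomorphicRepData 2 F hF2} {ν η : CuspidalAutomorphicRepData 1 F hF1}
    (h : ∀ᶠ v in cofinite, ∀ α β : Multiset ℂ, π.1.HasSatakeParamAt v α →
      σ.1.HasSatakeParamAt v β → ∃ d : ℂ, ν.1.HasSatakeParamAt v {d} ∧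
        α = (((β ×ˢ β).map (fun p : ℂ × ℂ => p.1 * p.2⁻¹)).erase 1).map (fun c => d * c))
    (hη : ∀ᶠ v in cofinite, ∀ α : Multiset ℂ, π.1.HasSatakeParamAt v α →
      ∃ e : ℂ, η.1.HasSatakeParamAt v {e} ∧ α.map (fun a => a⁻¹) = α.map (fun a => e * a)) :
    ∀ᶠ v in cofinite, ∀ d e : ℂ, ν.1.HasSatakeParamAt v {d} → η.1.HasSatakeParamAt v {e} →
      (e * d ^ 2) ^ 3 = 1 := by
  have hcof : ∀ᶠ v in cofinite, π.1.IsUnramifiedAt v := π.1.hasSatakeParamAt_cofinite_holds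
  filter_upwards [adRel_cube h, essSelfDual_cube hη, hcof] with v hv hv' hur d e hd he
  obtain ⟨α, hα⟩ := hur
  have hA := hv α d hα hd
  have hB := hv' α e hα he
  rw [hA] at hB
  linear_combination hB

/-! ### Global: Hecke characters -/

/-- Powers of Hecke characters at uniformizers. [folklore] -/
theorem valueAtUniformizer_pow (θ : HeckeCharacter F) (n : ℕ) (v : HeightOneSpectrum (𝓞 F)) :
    (θ ^ n).valueAtUniformizer v = θ.valueAtUniformizer v ^ n := by
  simp [HeckeCharacter.valueAtUniformizer, HeckeCharacter.localComponent_apply]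

/-- **`ν³ = ω_π` globally.**  If `t_π = ν · Ad(t_σ)` a.e. then the Hecke character `θ` of the GL(1)
datum `ν` (`exists_heckeCharacter_satake_eq` of `Negative/KillCriterion.lean`) and the central
character `ω` of `π` (`AutomorphicRepData.exists_centralCharacter`: `ω(ϖ_v) = det t_{π,v}` at every
unramified `v`)
satisfy `θ³ = ω` (rigidity of Hecke characters,
`HeckeCharacter.ext_of_eventually_valueAtUniformizer_eq`).  Consequently the algebraicity of `ν`
demanded by the crux is decided by the central character of `π` alone.
[cite: BorelJacquetCorvallis1979, §4.6 and 5.7] [cite: CasselsFrohlichANT1967, Ch. VII §4 Prop. 4.1] -/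
theorem adRel_heckeCharacter_cube_eq_centralCharacter {π : CuspidalAutomorphicRepData 3 F hF3}
    {σ : CuspidalAutomorphicRepData 2 F hF2} {ν : CuspidalAutomorphicRepData 1 F hF1}
    (h : ∀ᶠ v in cofinite, ∀ α β : Multiset ℂ, π.1.HasSatakeParamAt v α →
      σ.1.HasSatakeParamAt v β → ∃ d : ℂ, ν.1.HasSatakeParamAt v {d} ∧
        α = (((β ×ˢ β).map (fun p : ℂ × ℂ => p.1 * p.2⁻¹)).erase 1).map (fun c => d * c)) :
    ∃ θ ω : HeckeCharacter F,
      (∀ (v : HeightOneSpectrum (𝓞 F)) (d : ℂ), ν.1.HasSatakeParamAt v {d} →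
        d = θ.valueAtUniformizer v) ∧
      (∀ (v : HeightOneSpectrum (𝓞 F)) (α : Multiset ℂ), π.1.HasSatakeParamAt v α →
        ω.valueAtUniformizer v = α.prod) ∧
      θ ^ 3 = ω := by
  obtain ⟨θ, hθ⟩ := exists_heckeCharacter_satake_eq ν
  obtain ⟨ω, -, hω⟩ := π.1.exists_centralCharacter
  refine ⟨θ, ω, hθ, fun v α hα => (hω hα).2, ?_⟩
  apply HeckeCharacter.ext_of_eventually_valueAtUniformizer_eq
  filter_upwards [adRel_cube h, π.1.hasSatakeParamAt_cofinite_holds,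
    eventually_exists_hasSatakeParamAt_singleton ν] with v hv hπ hν
  obtain ⟨α, hα⟩ := hπ
  obtain ⟨d, hd⟩ := hν
  rw [valueAtUniformizer_pow, ← hθ v d hd, ← hv α d hα hd, (hω hα).2]

/-- **`η³ ω_π² = 1` globally**: the Hecke character `ε` of the self-duality datum `η` and the central
character `ω` of `π` satisfy `ε³ ω² = 1` (so `η`, hence `d² e`, is pinned by `π` up to cubic
characters). [cite: Ramakrishnan2014, Theorem A] [cite: BorelJacquetCorvallis1979, §4.6 and 5.7] -/
theorem essSelfDual_heckeCharacter_cube {π : CuspidalAutomorphicRepData 3 F hF3}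
    {η : CuspidalAutomorphicRepData 1 F hF1}
    (h : ∀ᶠ v in cofinite, ∀ α : Multiset ℂ, π.1.HasSatakeParamAt v α →
      ∃ e : ℂ, η.1.HasSatakeParamAt v {e} ∧ α.map (fun a => a⁻¹) = α.map (fun a => e * a)) :
    ∃ ε ω : HeckeCharacter F,
      (∀ (v : HeightOneSpectrum (𝓞 F)) (e : ℂ), η.1.HasSatakeParamAt v {e} →
        e = ε.valueAtUniformizer v) ∧
      (∀ (v : HeightOneSpectrum (𝓞 F)) (α : Multiset ℂ), π.1.HasSatakeParamAt v α →
        ω.valueAtUniformizer v = α.prod) ∧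
      ε ^ 3 * ω ^ 2 = 1 := by
  obtain ⟨ε, hε⟩ := exists_heckeCharacter_satake_eq η
  obtain ⟨ω, -, hω⟩ := π.1.exists_centralCharacter
  refine ⟨ε, ω, hε, fun v α hα => (hω hα).2, ?_⟩
  apply HeckeCharacter.ext_of_eventually_valueAtUniformizer_eq
  filter_upwards [essSelfDual_cube h, π.1.hasSatakeParamAt_cofinite_holds,
    eventually_exists_hasSatakeParamAt_singleton η] with v hv hπ hη
  obtain ⟨α, hα⟩ := hπ
  obtain ⟨e, he⟩ := hη
  have hmul : (ε ^ 3 * ω ^ 2).valueAtUniformizer v =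
      ε.valueAtUniformizer v ^ 3 * ω.valueAtUniformizer v ^ 2 := by
    simp [HeckeCharacter.valueAtUniformizer, HeckeCharacter.localComponent_apply]
  have hone : (1 : HeckeCharacter F).valueAtUniformizer v = 1 := by
    simp [HeckeCharacter.valueAtUniformizer, HeckeCharacter.localComponent_apply]
  rw [hmul, hone, ← hε v e he, (hω hα).2]
  exact hv α e hα he

/-! ### The archimedean shadow (exponent bookkeeping; Mathlib-only) -/

/-- **The arithmetic of "`ν` is algebraic" (purity closes it).**  At a complex place with embeddings
`σ, σ̄`: `ν_w = z^P z̄^Q` is a character of `ℂˣ` (`P - Q ∈ ℤ`); `ν³ = ω_π` gives `3P = A`, `3Q = B`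
with `A = A_σ`, `B = A_σ̄` the sums of the Harish-Chandra exponents of `π` (integers: `π` regular
algebraic on `GL₃`); Clozel purity `p_i + q_i = w` summed gives `A + B = 3w`.  Then `P, Q ∈ ℤ`.  (At a
real place the same with `A = B`.) [cite: Clozel1990, Lemme 4.9 (pureté)] -/
theorem nuShadow_integral (A B m w : ℤ) (P Q : ℂ) (hP : 3 * P = A) (hQ : 3 * Q = B)
    (hPQ : P - Q = m) (hpure : (A : ℂ) + B = 3 * w) : ∃ k l : ℤ, P = k ∧ Q = l := by
  refine ⟨2 * (m + w) - A, 2 * (m + w) - A - m, ?_, ?_⟩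
  · push_cast
    linear_combination (-1 / 3 : ℂ) * hP + (2 / 3 : ℂ) * hQ + 2 * hPQ + (2 / 3 : ℂ) * hpure
  · push_cast
    linear_combination (-1 / 3 : ℂ) * hP + (2 / 3 : ℂ) * hQ + hPQ + (2 / 3 : ℂ) * hpure

/-- **Purity is load-bearing**: `A = 1`, `B = 4`, `ν_w = z^{1/3} z̄^{4/3}` is a character of `ℂˣ`
(`P - Q = -1`) with `3P = A`, `3Q = B` and `P ∉ ℤ`. [folklore] -/
theorem nuShadow_needs_purity : ∃ (A B m : ℤ) (P Q : ℂ), 3 * P = A ∧ 3 * Q = B ∧ P - Q = m ∧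
    ∀ k : ℤ, P ≠ k := by
  refine ⟨1, 4, -1, 1 / 3, 4 / 3, by push_cast; ring, by push_cast; ring, by push_cast; ring,
    fun k hk => ?_⟩
  have h3 : (1 : ℂ) = 3 * k := by linear_combination 3 * hk
  have h3' : (1 : ℤ) = 3 * k := by exact_mod_cast h3
  omega

/-- **The character condition `P - Q ∈ ℤ` is load-bearing**: `A = 1`, `B = 2` is pure (`w = 1`) and
`P = 1/3`, `Q = 2/3` solve `3P = A`, `3Q = B` with `P ∉ ℤ` — excluded only because `z^{1/3} z̄^{2/3}`
is not a character of `ℂˣ`; so `3 ∣ A_σ` is not a consequence of purity alone. [folklore] -/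
theorem nuShadow_needs_character : ∃ (A B w : ℤ) (P Q : ℂ), 3 * P = A ∧ 3 * Q = B ∧
    (A : ℂ) + B = 3 * w ∧ ∀ k : ℤ, P ≠ k := by
  refine ⟨1, 2, 1, 1 / 3, 2 / 3, by push_cast; ring, by push_cast; ring, by push_cast; ring,
    fun k hk => ?_⟩
  have h3 : (1 : ℂ) = 3 * k := by linear_combination 3 * hk
  have h3' : (1 : ℤ) = 3 * k := by exact_mod_cast h3
  omega

/-- **The centre of an essentially self-dual regular algebraic `π` on `GL₃` is a cube at infinity**:
from `η³ ω_π² = 1`, `η_w = z^p z̄^q` with `p - q ∈ ℤ`, `3p = -2A`, `3q = -2B`, and purity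
`A + B = 3w`, one gets `3 ∣ A` — a one-line sanity test on any candidate counterexample `π`
(`3 ∤ Σ_i a_{σ,i}` at some `σ` ⇒ not essentially self-dual, or not pure).
[cite: Clozel1990, Lemme 4.9 (pureté)] -/
theorem essSelfDual_centre_cube (A B w m : ℤ) (p q : ℂ) (hp : 3 * p = -2 * A)
    (hq : 3 * q = -2 * B) (hpq : p - q = m) (hpure : (A : ℂ) + B = 3 * w) :
    ∃ k : ℤ, A = 3 * k := by
  have h : (4 : ℂ) * A = 6 * w - 3 * m := by linear_combination hp - hq - 3 * hpq + 2 * hpure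
  have hz : 4 * A = 6 * w - 3 * m := by exact_mod_cast h
  exact ⟨2 * w - m - A, by omega⟩

/-- Tightness of `essSelfDual_centre_cube`: without purity, `A = 1`, `B = -2`,
`η_w = z^{-2/3} z̄^{4/3}` (`p - q = -2`) satisfies the centre identity with `3 ∤ A`. [folklore] -/
theorem essSelfDual_centre_cube_needs_purity : ∃ (A B m : ℤ) (p q : ℂ), 3 * p = -2 * A ∧
    3 * q = -2 * B ∧ p - q = m ∧ ∀ k : ℤ, A ≠ 3 * k :=
  ⟨1, -2, -2, -2 / 3, 4 / 3, by push_cast; ring, by push_cast; ring, by push_cast; ring,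
    fun k hk => by omega⟩

end Summit.Langlands.Langlands.Theorems.RegularAdjointLiftCM.Negative

end
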